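import Literature.Computability.Cryptography.EntropyFlattening
import HarnessLib

/-!
# Flattening conditional Shannon entropy by independent repetition

Companion of `EntropyFlattening.lean` (HRV13, Lemma 2.1 (1): Hoeffding tails for the sample entropy
of `Xᵗ`, for sources `X = x(U_Ω)` generated by finitely many coins). This file proves the
**conditional** half of the printed lemma:

> **Haitner–Reingold–Vadhan 2013, Lemma 2.1 (2).** Let `X, Y` be jointly distributed random
> variables where `X` takes values in a universe `U`, let `t ∈ ℕ`, and let `ε > 0`. Then with
> probability at least `1 − ε − 2^{−Ω(t)}` over `(x, y) ← (Xᵗ, Yᵗ) := (X, Y)ᵗ`,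
> `|H_{Xᵗ|Yᵗ}(x|y) − t · H(X|Y)| ≤ O(√(t · log(1/ε)) · log(|U| · t))`.

("Proof. 2. Similar, noting that `H_{Xᵗ|Yᵗ}(x|y) = Σᵢ H_{X|Y}(xᵢ|yᵢ)`.") Here
`H_{X|Y}(a|b) = log₂ (Pr[Y = b] / Pr[X = a, Y = b])` is the conditional sample entropy and
`H(X|Y) = E[H_{X|Y}]` (HRV13, §2.2).

## What is proved (explicit constants; jointly coin-generated `(X, Y) = (x, y)(U_Ω)`)

For maps `x : Ω → U`, `y : Ω → V` on a finite nonempty coin type `Ω` (so `(X, Y)` is the joint law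
of `(x w, y w)` for uniform `w`), the conditional sample entropy of the outcome of the coins `w` is
`H_{X|Y}(w) = log₂ (|y⁻¹(y w)| / |(x,y)⁻¹(x w, y w)|)`, which is the difference of the two sample
entropies `H_{(X,Y)}(w) − H_Y(w)` (`condSampleEntropy_eq_sub`) and lies in `[0, log₂ |Ω|]`
(`condSampleEntropy_nonneg/_le`); its mean is `H(X|Y) = H(X,Y) − H(Y)`, in the tree
`mapEntropy univ (x, y) − mapEntropy univ y` (`condEntropy_eq`, the chain rule). Then:

* `condSampleEntropy_tuple` — **`H_{Xᵗ|Yᵗ}(w) = Σᵢ H_{X|Y}(wᵢ)`** (from `sampleEntropy_tuple` for the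
  pair map and for `y`);
* `card_condSampleEntropy_tuple_ge_le_exp` / `…_le_le_exp` — Hoeffding tails: for `t ≥ 1`, `η ≥ 0`,
  `|Ω| ≥ 2`, the coin tuples with `Σᵢ H_{X|Y}(wᵢ) ≥ t·H(X|Y) + tη·log₂|Ω|` (resp.
  `≤ t·H(X|Y) − tη·log₂|Ω|`) number at most `exp(−2tη²) · |Ω|ᵗ` each;
* `card_condHeavy_tuple_le_exp` — **conditional smooth min-entropy**: all but an `exp(−2tη²)`
  fraction of `w ∈ Ωᵗ` satisfies
  `Pr[Xᵗ = xᵗ w | Yᵗ = yᵗ w] = |(x,y)ᵗ-fibre| / |yᵗ-fibre| < 2^{−(t·H(X|Y) − tη·log₂|Ω|)}`.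

Everything is proved; no new definitions (the conditional entropy appears as the difference of two
`mapEntropy`s). As with `EntropyFlattening.lean`, boundedness of the sample entropies of
coin-generated sources makes plain Hoeffding applicable (deviation `tη·log₂|Ω|` at confidence
`exp(−2tη²)`, in place of the paper's `O(√(t log(1/ε)) · log(|U|·t))` at confidence
`ε + 2^{−Ω(t)}`).

## References

* I. Haitner, O. Reingold, S. Vadhan, *Efficiency improvements in constructing pseudorandom
  generators from one-way functions*, SIAM J. Comput. 42(3) (2013) 1405–1430,
  doi:10.1137/100814421: §2.2 and Lemma 2.1 (2) with its proof.
* T. Cover, J. Thomas, *Elements of Information Theory*, 2nd ed., Wiley 2006, Thm. 2.2.1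
  (chain rule `H(X, Y) = H(Y) + H(X | Y)`), Thm. 2.6.6.
* W. Hoeffding, *Probability inequalities for sums of bounded random variables*, JASA 58 (1963),
  Thm. 2 (through `SamplingChernoff.lean`).
-/

namespace Literature.Computability.Cryptography

open Finset Real

section CondFlattening

variable {Ω U V : Type*} [Fintype Ω] [DecidableEq U] [DecidableEq V]

/-! ### Conditional sample entropy of a jointly coin-generated pair -/

/-- The joint fibre is contained in the fibre of the conditioning variable:
`(x,y)⁻¹(x w, y w) ⊆ y⁻¹(y w)`. [folklore] -/
theorem jointFiber_subset_fiber (x : Ω → U) (y : Ω → V) (w : Ω) :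
    fiber univ (fun v => (x v, y v)) (x w, y w) ⊆ fiber univ y (y w) := by
  intro v hv
  rw [mem_fiber] at hv ⊢
  exact ⟨hv.1, (Prod.mk.inj hv.2).2⟩

/-- `|(x,y)⁻¹(x w, y w)| ≤ |y⁻¹(y w)|`. [folklore] -/
theorem card_jointFiber_le (x : Ω → U) (y : Ω → V) (w : Ω) :
    (fiber univ (fun v => (x v, y v)) (x w, y w)).card ≤ (fiber univ y (y w)).card :=
  Finset.card_le_card (jointFiber_subset_fiber x y w)

/-- **Conditional sample entropy is a difference of sample entropies** (pointwise chain rule):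
`log₂ (|y⁻¹(y w)| / |(x,y)⁻¹(x w, y w)|) = H_{(X,Y)}(w) − H_Y(w)`.
[Cover–Thomas 2006, Thm. 2.2.1 (chain rule); Haitner–Reingold–Vadhan 2013, §2.2]
[cite: HaitnerReingoldVadhan2013, §2.2] -/
theorem condSampleEntropy_eq_sub (x : Ω → U) (y : Ω → V) (w : Ω) :
    Real.logb 2 (((fiber univ y (y w)).card : ℝ) / (fiber univ (fun v => (x v, y v)) (x w, y w)).card) =
      Real.logb 2 ((Fintype.card Ω : ℝ) / (fiber univ (fun v => (x v, y v)) (x w, y w)).card) -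
        Real.logb 2 ((Fintype.card Ω : ℝ) / (fiber univ y (y w)).card) := by
  have hΩ : (0 : ℝ) < Fintype.card Ω := by
    have : 0 < Fintype.card Ω := Fintype.card_pos_iff.2 ⟨w⟩
    exact_mod_cast this
  have hJ : (0 : ℝ) < (fiber univ (fun v => (x v, y v)) (x w, y w)).card := by
    exact_mod_cast card_fiber_univ_pos (fun v => (x v, y v)) w
  have hY : (0 : ℝ) < (fiber univ y (y w)).card := by exact_mod_cast card_fiber_univ_pos y w
  rw [Real.logb_div hY.ne' hJ.ne', Real.logb_div hΩ.ne' hJ.ne', Real.logb_div hΩ.ne' hY.ne']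
  ring

/-- Conditional sample entropy is nonnegative. [Haitner–Reingold–Vadhan 2013, §2.2] [folklore] -/
theorem condSampleEntropy_nonneg (x : Ω → U) (y : Ω → V) (w : Ω) :
    0 ≤ Real.logb 2 (((fiber univ y (y w)).card : ℝ) / (fiber univ (fun v => (x v, y v)) (x w, y w)).card) := by
  have hJ : (0 : ℝ) < (fiber univ (fun v => (x v, y v)) (x w, y w)).card := by
    exact_mod_cast card_fiber_univ_pos (fun v => (x v, y v)) w
  refine Real.logb_nonneg (by norm_num) ?_
  rw [le_div_iff₀ hJ, one_mul]
  exact_mod_cast card_jointFiber_le x y w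

/-- Conditional sample entropy is at most `log₂ |Ω|`. [Haitner–Reingold–Vadhan 2013, §2.2] [folklore] -/
theorem condSampleEntropy_le (x : Ω → U) (y : Ω → V) (w : Ω) :
    Real.logb 2 (((fiber univ y (y w)).card : ℝ) / (fiber univ (fun v => (x v, y v)) (x w, y w)).card) ≤
      Real.logb 2 (Fintype.card Ω) := by
  rw [condSampleEntropy_eq_sub]
  have h1 := logb_card_div_card_fiber_le (S := univ) (fun v => (x v, y v)) (Finset.mem_univ w)
  have h2 := logb_card_div_card_fiber_nonneg (S := univ) y (Finset.mem_univ w)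
  rw [Finset.card_univ] at h1 h2
  linarith

/-- **Chain rule**: the mean conditional sample entropy is `H(X|Y) = H(X,Y) − H(Y)`, i.e.
`(1/|Ω|) Σ_w log₂ (|y⁻¹(y w)| / |(x,y)⁻¹(x w, y w)|) = mapEntropy univ (x,y) − mapEntropy univ y`.
[Cover–Thomas 2006, Thm. 2.2.1] [cite: CoverThomas2005, Thm. 2.2.1 (chain rule)] -/
theorem condEntropy_eq [Nonempty Ω] (x : Ω → U) (y : Ω → V) :
    (∑ w : Ω, Real.logb 2 (((fiber univ y (y w)).card : ℝ) /
        (fiber univ (fun v => (x v, y v)) (x w, y w)).card)) / Fintype.card Ω =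
      mapEntropy univ (fun v => (x v, y v)) - mapEntropy univ y := by
  unfold mapEntropy
  rw [Finset.card_univ, ← sub_div, ← Finset.sum_sub_distrib]
  congr 1
  exact Finset.sum_congr rfl fun w _ => condSampleEntropy_eq_sub x y w

/-! ### Independent repetitions -/

/-- **Conditional sample entropy is additive over independent repetitions**:
`H_{Xᵗ|Yᵗ}(w) = Σᵢ H_{X|Y}(wᵢ)`, i.e. `log₂ (|yᵗ-fibre| / |(x,y)ᵗ-fibre|) = Σᵢ log₂ (|y⁻¹(y wᵢ)| /
|(x,y)⁻¹(x wᵢ, y wᵢ)|)`. [Haitner–Reingold–Vadhan 2013, proof of Lemma 2.1 (2)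
("`H_{Xᵗ|Yᵗ}(x|y) = Σᵢ H_{X|Y}(xᵢ|yᵢ)`")] [cite: HaitnerReingoldVadhan2013, Lemma 2.1 (2) (proof)] -/
theorem condSampleEntropy_tuple (x : Ω → U) (y : Ω → V) {t : ℕ} (w : Fin t → Ω) :
    Real.logb 2 (((fiber univ (fun v : Fin t → Ω => fun i => y (v i)) (fun i => y (w i))).card : ℝ) /
        (fiber univ (fun v : Fin t → Ω => fun i => (x (v i), y (v i))) (fun i => (x (w i), y (w i)))).card) =
      ∑ i, Real.logb 2 (((fiber univ y (y (w i))).card : ℝ) /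
        (fiber univ (fun v => (x v, y v)) (x (w i), y (w i))).card) := by
  have hxy := sampleEntropy_tuple (fun v => (x v, y v)) w
  have hy := sampleEntropy_tuple y w
  have hΩt : (0 : ℝ) < Fintype.card (Fin t → Ω) := by
    have : 0 < Fintype.card (Fin t → Ω) := Fintype.card_pos_iff.2 ⟨w⟩
    exact_mod_cast this
  have hJ : (0 : ℝ) < (fiber univ (fun v : Fin t → Ω => fun i => (x (v i), y (v i)))
      (fun i => (x (w i), y (w i)))).card := by
    exact_mod_cast card_fiber_univ_pos (fun v : Fin t → Ω => fun i => (x (v i), y (v i))) w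
  have hY : (0 : ℝ) < (fiber univ (fun v : Fin t → Ω => fun i => y (v i)) (fun i => y (w i))).card := by
    exact_mod_cast card_fiber_univ_pos (fun v : Fin t → Ω => fun i => y (v i)) w
  calc Real.logb 2 (((fiber univ (fun v : Fin t → Ω => fun i => y (v i)) (fun i => y (w i))).card : ℝ) /
        (fiber univ (fun v : Fin t → Ω => fun i => (x (v i), y (v i))) (fun i => (x (w i), y (w i)))).card)
      = Real.logb 2 ((Fintype.card (Fin t → Ω) : ℝ) /
            (fiber univ (fun v : Fin t → Ω => fun i => (x (v i), y (v i))) (fun i => (x (w i), y (w i)))).card) -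
          Real.logb 2 ((Fintype.card (Fin t → Ω) : ℝ) /
            (fiber univ (fun v : Fin t → Ω => fun i => y (v i)) (fun i => y (w i))).card) := by
        rw [Real.logb_div hY.ne' hJ.ne', Real.logb_div hΩt.ne' hJ.ne', Real.logb_div hΩt.ne' hY.ne']
        ring
    _ = ∑ i, Real.logb 2 ((Fintype.card Ω : ℝ) / (fiber univ (fun v => (x v, y v)) (x (w i), y (w i))).card) -
          ∑ i, Real.logb 2 ((Fintype.card Ω : ℝ) / (fiber univ y (y (w i))).card) := by rw [hxy, hy]
    _ = ∑ i, Real.logb 2 (((fiber univ y (y (w i))).card : ℝ) /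
          (fiber univ (fun v => (x v, y v)) (x (w i), y (w i))).card) := by
        rw [← Finset.sum_sub_distrib]
        exact Finset.sum_congr rfl fun i _ => (condSampleEntropy_eq_sub x y (w i)).symm

/-! ### Hoeffding tails for the conditional sample entropy of `(X, Y)ᵗ` -/

/-- **Upper tail**: for `t ≥ 1`, `η ≥ 0`, `|Ω| ≥ 2`, the coin tuples `w ∈ Ωᵗ` with
`Σᵢ H_{X|Y}(wᵢ) ≥ t·H(X|Y) + tη·log₂|Ω|` number at most `exp(−2tη²) · |Ω|ᵗ`.
[Haitner–Reingold–Vadhan 2013, Lemma 2.1 (2); Hoeffding 1963, Thm. 2]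
[cite: HaitnerReingoldVadhan2013, Lemma 2.1 (2)] -/
theorem card_condSampleEntropy_tuple_ge_le_exp [Nonempty Ω] (x : Ω → U) (y : Ω → V) {t : ℕ}
    (ht : 0 < t) {η : ℝ} (hη : 0 ≤ η) (hΩ : 1 < Fintype.card Ω) :
    ((univ.filter fun w : Fin t → Ω =>
        t * (mapEntropy univ (fun v => (x v, y v)) - mapEntropy univ y) +
            t * η * Real.logb 2 (Fintype.card Ω) ≤
          ∑ i, Real.logb 2 (((fiber univ y (y (w i))).card : ℝ) /
            (fiber univ (fun v => (x v, y v)) (x (w i), y (w i))).card)).card : ℝ) ≤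
      Real.exp (-2 * t * η ^ 2) * (Fintype.card Ω : ℝ) ^ t := by
  classical
  set L : ℝ := Real.logb 2 (Fintype.card Ω) with hL
  set Hs : Ω → ℝ := fun a => Real.logb 2 (((fiber univ y (y a)).card : ℝ) /
    (fiber univ (fun v => (x v, y v)) (x a, y a)).card) with hHs
  set Hc : ℝ := mapEntropy univ (fun v => (x v, y v)) - mapEntropy univ y with hHc
  have hΩR : (1 : ℝ) < Fintype.card Ω := by exact_mod_cast hΩ
  have hΩ0 : (0 : ℝ) < Fintype.card Ω := by linarith
  have hL0 : 0 < L := Real.logb_pos (by norm_num) hΩR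
  set F : Ω → ℝ := fun a => Hs a / L with hFdef
  have hF : ∀ a, F a ∈ Set.Icc (0 : ℝ) 1 := fun a =>
    ⟨div_nonneg (condSampleEntropy_nonneg x y a) hL0.le,
      by rw [div_le_one hL0]; exact condSampleEntropy_le x y a⟩
  have h := Complexity.card_upperDeviation_sum_le_exp F hF ht hη
  rw [Fintype.card_pi_const, Nat.cast_pow] at h
  refine le_trans ?_ h
  refine Nat.cast_le.2 (Finset.card_le_card fun w hw => ?_)
  rw [Finset.mem_filter] at hw ⊢
  refine ⟨Finset.mem_univ _, ?_⟩
  have havg : (∑ a, F a) / Fintype.card Ω = Hc / L := by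
    simp only [hFdef]
    rw [← Finset.sum_div, div_right_comm, hHs]
    simp only []
    rw [condEntropy_eq x y]
  have hsumF : ∑ i, F (w i) = (∑ i, Hs (w i)) / L := by
    simp only [hFdef]
    rw [Finset.sum_div]
  rw [havg, hsumF]
  have hw2 : (t : ℝ) * Hc + t * η * L ≤ ∑ i, Hs (w i) := hw.2
  rw [show (∑ i, Hs (w i)) / L - (t : ℝ) * (Hc / L) = ((∑ i, Hs (w i)) - t * Hc) / L by field_simp]
  rw [le_div_iff₀ hL0]
  linarith

/-- **Lower tail**: for `t ≥ 1`, `η ≥ 0`, `|Ω| ≥ 2`, the coin tuples `w ∈ Ωᵗ` with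
`Σᵢ H_{X|Y}(wᵢ) ≤ t·H(X|Y) − tη·log₂|Ω|` number at most `exp(−2tη²) · |Ω|ᵗ`.
[Haitner–Reingold–Vadhan 2013, Lemma 2.1 (2); Hoeffding 1963, Thm. 2]
[cite: HaitnerReingoldVadhan2013, Lemma 2.1 (2)] -/
theorem card_condSampleEntropy_tuple_le_le_exp [Nonempty Ω] (x : Ω → U) (y : Ω → V) {t : ℕ}
    (ht : 0 < t) {η : ℝ} (hη : 0 ≤ η) (hΩ : 1 < Fintype.card Ω) :
    ((univ.filter fun w : Fin t → Ω =>
        ∑ i, Real.logb 2 (((fiber univ y (y (w i))).card : ℝ) /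
            (fiber univ (fun v => (x v, y v)) (x (w i), y (w i))).card) ≤
          t * (mapEntropy univ (fun v => (x v, y v)) - mapEntropy univ y) -
            t * η * Real.logb 2 (Fintype.card Ω)).card : ℝ) ≤
      Real.exp (-2 * t * η ^ 2) * (Fintype.card Ω : ℝ) ^ t := by
  classical
  set L : ℝ := Real.logb 2 (Fintype.card Ω) with hL
  set Hs : Ω → ℝ := fun a => Real.logb 2 (((fiber univ y (y a)).card : ℝ) /
    (fiber univ (fun v => (x v, y v)) (x a, y a)).card) with hHs
  set Hc : ℝ := mapEntropy univ (fun v => (x v, y v)) - mapEntropy univ y with hHc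
  have hΩR : (1 : ℝ) < Fintype.card Ω := by exact_mod_cast hΩ
  have hΩ0 : (0 : ℝ) < Fintype.card Ω := by linarith
  have hL0 : 0 < L := Real.logb_pos (by norm_num) hΩR
  set F : Ω → ℝ := fun a => Hs a / L with hFdef
  have hF : ∀ a, F a ∈ Set.Icc (0 : ℝ) 1 := fun a =>
    ⟨div_nonneg (condSampleEntropy_nonneg x y a) hL0.le,
      by rw [div_le_one hL0]; exact condSampleEntropy_le x y a⟩
  have hF' : ∀ a, (1 - F a) ∈ Set.Icc (0 : ℝ) 1 := fun a =>
    ⟨sub_nonneg.2 (hF a).2, sub_le_self _ (hF a).1⟩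
  have h := Complexity.card_upperDeviation_sum_le_exp (fun a => 1 - F a) hF' ht hη
  rw [Fintype.card_pi_const, Nat.cast_pow] at h
  refine le_trans ?_ h
  refine Nat.cast_le.2 (Finset.card_le_card fun w hw => ?_)
  rw [Finset.mem_filter] at hw ⊢
  refine ⟨Finset.mem_univ _, ?_⟩
  have havg : (∑ a, F a) / Fintype.card Ω = Hc / L := by
    simp only [hFdef]
    rw [← Finset.sum_div, div_right_comm, hHs]
    simp only []
    rw [condEntropy_eq x y]
  have hsumF : ∑ i, F (w i) = (∑ i, Hs (w i)) / L := by
    simp only [hFdef]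
    rw [Finset.sum_div]
  have hsum1 : ∑ i : Fin t, (1 - F (w i)) = t - ∑ i, F (w i) := by
    rw [Finset.sum_sub_distrib, Finset.sum_const, Finset.card_univ, Fintype.card_fin, nsmul_eq_mul,
      mul_one]
  have havg1 : (∑ a, (1 - F a)) / Fintype.card Ω = 1 - (∑ a, F a) / Fintype.card Ω := by
    rw [Finset.sum_sub_distrib, Finset.sum_const, Finset.card_univ, nsmul_eq_mul, mul_one, sub_div,
      div_self hΩ0.ne']
  rw [hsum1, havg1, havg, hsumF]
  have hw2 : ∑ i, Hs (w i) ≤ (t : ℝ) * Hc - t * η * L := hw.2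
  rw [show (t : ℝ) - (∑ i, Hs (w i)) / L - t * (1 - Hc / L) = (t * Hc - ∑ i, Hs (w i)) / L by
    field_simp; ring]
  rw [le_div_iff₀ hL0]
  linarith

/-! ### Conditional flattening -/

/-- **Flattening conditional entropy to conditional min-entropy**: for `t ≥ 1`, `η ≥ 0`,
`|Ω| ≥ 2`, the coin tuples `w ∈ Ωᵗ` for which the conditional probability
`Pr[Xᵗ = xᵗ w | Yᵗ = yᵗ w] = |(x,y)ᵗ-fibre through w| / |yᵗ-fibre through w|` is at least
`2^{−(t·H(X|Y) − tη·log₂|Ω|)}` number at most `exp(−2tη²) · |Ω|ᵗ`: with probability `1 − exp(−2tη²)`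
over `(x, y) ← (X, Y)ᵗ`, the sample `x` has conditional sample entropy
`> t·H(X|Y) − tη·log₂|Ω|` given `y`. [Haitner–Reingold–Vadhan 2013, Lemma 2.1 (2)]
[cite: HaitnerReingoldVadhan2013, Lemma 2.1 (2)] -/
theorem card_condHeavy_tuple_le_exp [Nonempty Ω] (x : Ω → U) (y : Ω → V) {t : ℕ} (ht : 0 < t)
    {η : ℝ} (hη : 0 ≤ η) (hΩ : 1 < Fintype.card Ω) :
    ((univ.filter fun w : Fin t → Ω =>
        (2 : ℝ) ^ (-(t * (mapEntropy univ (fun v => (x v, y v)) - mapEntropy univ y) -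
              t * η * Real.logb 2 (Fintype.card Ω))) *
            ((fiber univ (fun v : Fin t → Ω => fun i => y (v i)) (fun i => y (w i))).card : ℝ) ≤
          ((fiber univ (fun v : Fin t → Ω => fun i => (x (v i), y (v i)))
            (fun i => (x (w i), y (w i)))).card : ℝ)).card : ℝ) ≤
      Real.exp (-2 * t * η ^ 2) * (Fintype.card Ω : ℝ) ^ t := by
  classical
  refine le_trans ?_ (card_condSampleEntropy_tuple_le_le_exp x y ht hη hΩ)
  refine Nat.cast_le.2 (Finset.card_le_card fun w hw => ?_)
  rw [Finset.mem_filter] at hw ⊢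
  refine ⟨Finset.mem_univ _, ?_⟩
  set k : ℝ := t * (mapEntropy univ (fun v => (x v, y v)) - mapEntropy univ y) -
    t * η * Real.logb 2 (Fintype.card Ω) with hk
  set Jw := fiber univ (fun v : Fin t → Ω => fun i => (x (v i), y (v i))) (fun i => (x (w i), y (w i)))
    with hJw
  set Yw := fiber univ (fun v : Fin t → Ω => fun i => y (v i)) (fun i => y (w i)) with hYw
  have hJpos : (0 : ℝ) < Jw.card := by
    exact_mod_cast card_fiber_pos (fun v : Fin t → Ω => fun i => (x (v i), y (v i))) (Finset.mem_univ w)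
  have hYpos : (0 : ℝ) < Yw.card := by
    exact_mod_cast card_fiber_pos (fun v : Fin t → Ω => fun i => y (v i)) (Finset.mem_univ w)
  -- `Σᵢ H_{X|Y}(wᵢ) = log₂ (|Yw| / |Jw|) ≤ k`
  rw [← condSampleEntropy_tuple x y w]
  rw [Real.logb_le_iff_le_rpow (by norm_num) (div_pos hYpos hJpos), div_le_iff₀ hJpos]
  have hw2 : (2 : ℝ) ^ (-k) * Yw.card ≤ Jw.card := hw.2
  calc (Yw.card : ℝ) = (2 : ℝ) ^ k * ((2 : ℝ) ^ (-k) * Yw.card) := by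
        rw [← mul_assoc, ← Real.rpow_add (by norm_num), add_neg_cancel, Real.rpow_zero, one_mul]
    _ ≤ (2 : ℝ) ^ k * Jw.card := mul_le_mul_of_nonneg_left hw2 (by positivity)

end CondFlattening

end Literature.Computability.Cryptography
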